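import Literature.NumberTheory.Transcendental.ProjectiveSpace
import Literature.NumberTheory.Transcendental.ProjectiveSpaceT2Proofs
import Mathlib.Analysis.Normed.Module.FiniteDimension
import Mathlib.Analysis.RCLike.Lemmas
import Mathlib.LinearAlgebra.Dual.Lemmas
import HarnessLib

/-!
# Projective spaces `ℙ K V`: functoriality, coordinate-free Hausdorffness/compactness, functional charts

Topic `Literature/AlgebraicTopology/CharacteristicClasses`. Complements the tree's
`Literature/NumberTheory/Transcendental/ProjectiveSpace.lean` (the quotient topology
`Projectivization.instTopologicalSpace` on Mathlib's `ℙ K V`, `Projectivization.isQuotientMap_mk`,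
`isOpenQuotientMap_mk`, `compactSpace_of_properSpace`, and the COORDINATE charts `stdChart i` of
`ℙ K (Fin (n+1) → K)`) and `ProjectiveSpaceT2Proofs.lean` (`Projectivization.t2Space_pi`) with
what the projective BUNDLE `P(ξ)` of a vector bundle with an abstract finite-dimensional fibre
`V` needs (Husemoller, *Fibre Bundles*, Ch. 17 Def. 2.1: the fibre of `Pξⁿ` is `FP^{n-1}`, the
fibre inclusions `j_b` and the coordinate changes are projectivised linear isomorphisms;
Hirzebruch, *Topological Methods*, §4.2: the open sets `Uᵢ = {zᵢ ≠ 0}`):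

* `Continuous.projectivizationMk`, `continuous_iff_comp_mk'`, `continuousOn_iff_comp_mk'` — maps
  into / out of `ℙ K V` through the quotient map;
* `continuous_map` — **functoriality**: an injective continuous linear map induces a continuous
  map `ℙ K V → ℙ K W` (`Projectivization.map`);
* `t2Space_of_finiteDimensional` — `ℙ K V` is Hausdorff for ANY finite-dimensional normed `V`
  over a complete field (transport of the tree's `t2Space_pi` along `ℙ` of a linear
  homeomorphism `V ≃L Kᵈ`); `compactSpace_of_finiteDimensional` — compact over `ℝ`, `ℂ`
  (the tree's `compactSpace_of_properSpace`);
* coordinate-free affine charts (Hirzebruch §4.2 with a functional `φ` in place of `zᵢ`):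
  `chartDomain φ = {[v] | φ v ≠ 0}` (open for `φ` continuous), the normalised representative
  `affineRep φ [v] = (φ v)⁻¹ • v` (`φ (affineRep φ p) = 1`, `[affineRep φ p] = p` on the chart,
  continuous there), and `exists_mem_chartDomain`. These are the charts over which the
  tautological line bundle of `ℙ K V` and of `P(ξ)` is trivial.

Everything is proved; no named facts, no instances.

## Design notes

* No new topology: the global instance of `ProjectiveSpace.lean` is used (Mathlib itself has none).
* `affineRep φ` is total on `ℙ K V` (value `0 • v = 0`-free junk `(0)⁻¹ • v = 0` off the chart);
  only its restriction to `chartDomain φ` is meaningful.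
* Tree/Mathlib searches: `Projectivization.map` + `Continuous` — only the specific instances
  `ComplexProjectiveSpace.continuous_lineIncl` (FourManifolds) and a dilation in
  `DworkSexticEigenspaces`; functional charts and the coordinate-free `T2Space` are not in the
  tree (`ComplexProjectiveSpace.affineChart`, `Projectivization.stdChart` are the coordinate
  charts of `Kⁿ⁺¹`). Nothing restated.

## References

* [HusemollerFibreBundles1994] D. Husemoller, *Fibre Bundles*, 3rd ed., GTM 20 (1994), Ch. 17
  Def. 2.1–Prop. 2.2 (projective bundle, fibre inclusions).
* [Hirzebruch1966] F. Hirzebruch, *Topological Methods in Algebraic Geometry*, 3rd ed. (1966),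
  §4.2 (the open sets `Uᵢ = {zᵢ ≠ 0}`, affine coordinates `zⱼ/zᵢ`).
-/

noncomputable section

open Function Set Filter Topology
open scoped LinearAlgebra.Projectivization

universe u v w

namespace Literature.AlgebraicTopology.CharacteristicClasses

/-! ### Maps into and out of `ℙ K V` -/

section Quotient

variable {K : Type u} {V : Type v} [DivisionRing K] [AddCommGroup V] [Module K V]
  [TopologicalSpace V]

/-- A continuous nowhere-vanishing map `f : X → V` induces a continuous map `x ↦ [f x]` into
`ℙ K V`. [folklore] -/
theorem _root_.Continuous.projectivizationMk {X : Type w} [TopologicalSpace X] {f : X → V}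
    (hf : Continuous f) (h0 : ∀ x, f x ≠ 0) :
    Continuous fun x ↦ Projectivization.mk K (f x) (h0 x) :=
  Projectivization.continuous_mk.comp (hf.subtype_mk h0)

/-- Universal property: a map out of `ℙ K V` is continuous iff its composite with `v ↦ [v]` is
(`Projectivization.isQuotientMap_mk`). [folklore] -/
theorem continuous_iff_comp_mk' {X : Type w} [TopologicalSpace X] {g : ℙ K V → X} :
    Continuous g ↔ Continuous (g ∘ Projectivization.mk' K) :=
  Projectivization.isQuotientMap_mk.continuous_iff

/-- A map out of `ℙ K V` is continuous on an OPEN subset iff its composite with `v ↦ [v]` is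
continuous on the preimage. [folklore] -/
theorem continuousOn_iff_comp_mk' {X : Type w} [TopologicalSpace X] {g : ℙ K V → X}
    {s : Set (ℙ K V)} (hs : IsOpen s) :
    ContinuousOn g s ↔ ContinuousOn (g ∘ Projectivization.mk' K) (Projectivization.mk' K ⁻¹' s) :=
  Projectivization.isQuotientMap_mk.continuousOn_isOpen_iff hs

end Quotient

/-! ### Functoriality -/

section Map

variable {K : Type u} {V : Type v} {W : Type w} [DivisionRing K] [AddCommGroup V] [Module K V]
  [TopologicalSpace V] [AddCommGroup W] [Module K W] [TopologicalSpace W]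

/-- **An injective continuous linear map induces a continuous map of projective spaces**
`[v] ↦ [f v]` (the fibre inclusions `j_b : FP^{n-1} → E'` of Husemoller Ch. 17 §2 and the
coordinate changes of `P(ξ)` are of this form). [cite: HusemollerFibreBundles1994, Ch. 17 §2 (2.1)–(2.2)] -/
theorem continuous_map (f : V →ₗ[K] W) (hf : Injective f) (hfc : Continuous f) :
    Continuous (Projectivization.map f hf) := by
  rw [continuous_iff_comp_mk']
  have h0 : ∀ v : {v : V // v ≠ 0}, f v ≠ 0 := fun v h ↦ v.2 (hf (by rw [h, map_zero]))
  have : (Projectivization.map f hf ∘ Projectivization.mk' K) =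
      fun v : {v : V // v ≠ 0} ↦ Projectivization.mk K (f v) (h0 v) := by
    funext v
    rw [comp_apply, Projectivization.mk'_eq_mk, Projectivization.map_mk]
  rw [this]
  exact (hfc.comp continuous_subtype_val).projectivizationMk h0

/-- `ℙ` of a linear homeomorphism is a homeomorphism of projective spaces. [folklore] -/
def homeomorphOfContinuousLinearEquiv (e : V ≃L[K] W) : ℙ K V ≃ₜ ℙ K W where
  toFun := Projectivization.map (e : V →ₗ[K] W) e.injective
  invFun := Projectivization.map (e.symm : W →ₗ[K] V) e.symm.injective
  left_inv p := by
    induction p using Projectivization.ind with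
    | h v hv => simp [Projectivization.map_mk]
  right_inv p := by
    induction p using Projectivization.ind with
    | h v hv => simp [Projectivization.map_mk]
  continuous_toFun := continuous_map _ e.injective e.continuous
  continuous_invFun := continuous_map _ e.symm.injective e.symm.continuous

end Map

/-! ### Hausdorffness and compactness for an abstract finite-dimensional fibre -/

section Separation

variable (K : Type u) (V : Type v) [NontriviallyNormedField K] [CompleteSpace K]
  [NormedAddCommGroup V] [NormedSpace K V] [FiniteDimensional K V]

/-- **`ℙ K V` is Hausdorff** for every finite-dimensional normed `V` over a complete nontrivially
normed field: `ℙ` of a linear homeomorphism `V ≃L K^d` is a continuous injection into the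
Hausdorff `ℙ K (Fin d → K)` of the tree (`Projectivization.t2Space_pi`). [folklore] -/
theorem t2Space_of_finiteDimensional : T2Space (ℙ K V) := by
  haveI : T2Space (ℙ K (Fin (Module.finrank K V) → K)) := Projectivization.t2Space_pi
  let e : V ≃L[K] (Fin (Module.finrank K V) → K) := ContinuousLinearEquiv.ofFinrankEq (by simp)
  exact T2Space.of_injective_continuous (homeomorphOfContinuousLinearEquiv e).injective
    (homeomorphOfContinuousLinearEquiv e).continuous

end Separation

section Compact

variable (K : Type u) (V : Type v) [RCLike K] [NormedAddCommGroup V] [NormedSpace K V]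
  [FiniteDimensional K V]

/-- **`ℙ K V` is compact** for `V` finite-dimensional normed over `K = ℝ, ℂ` (such `V` is proper;
the tree's `Projectivization.compactSpace_of_properSpace`): the fibre `FP^{n-1}` of a projective
bundle is compact. [cite: HusemollerFibreBundles1994, Ch. 17 Def. 2.1] -/
theorem compactSpace_of_finiteDimensional : CompactSpace (ℙ K V) := by
  haveI : ProperSpace V := FiniteDimensional.proper_rclike K V
  exact Projectivization.compactSpace_of_properSpace

end Compact

/-! ### Affine charts `{φ ≠ 0}` of a functional -/

section Chart

variable {K : Type u} {V : Type v} [Field K] [AddCommGroup V] [Module K V]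

/-- The **affine chart domain** `U_φ = {[v] | φ v ≠ 0} ⊆ ℙ K V` of a linear functional `φ`
(Hirzebruch §4.2: "The open sets `Uᵢ` defined by `zᵢ ≠ 0` form an open covering of `P_n(ℂ)`",
with `φ` for the coordinate `zᵢ`); well defined since `φ(t • v) = t φ(v)`. [cite: Hirzebruch1966, §4.2] -/
def chartDomain (φ : Module.Dual K V) : Set (ℙ K V) :=
  {p | Projectivization.lift (fun v : {v : V // v ≠ 0} ↦ φ v ≠ 0) (by
    rintro ⟨v, hv⟩ ⟨w, hw⟩ t (rfl : v = t • w)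
    have ht : t ≠ 0 := by rintro rfl; exact hv (zero_smul K w)
    simp only [ne_eq, map_smul, smul_eq_mul, mul_eq_zero, ht, false_or]) p}

/-- `[v] ∈ U_φ ↔ φ v ≠ 0`. [cite: Hirzebruch1966, §4.2] -/
@[simp]
theorem mk_mem_chartDomain_iff (φ : Module.Dual K V) (v : V) (hv : v ≠ 0) :
    Projectivization.mk K v hv ∈ chartDomain φ ↔ φ v ≠ 0 :=
  Iff.rfl

/-- The preimage of `U_φ` in `V ∖ {0}` is `{φ ≠ 0}`. [folklore] -/
theorem preimage_mk'_chartDomain (φ : Module.Dual K V) :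
    Projectivization.mk' K ⁻¹' (chartDomain φ : Set (ℙ K V)) =
      {v : {v : V // v ≠ 0} | φ (v : V) ≠ 0} := rfl

/-- **Every point lies in some affine chart**: for `[v]` take any functional with `φ v ≠ 0`.
[cite: Hirzebruch1966, §4.2] -/
theorem exists_mem_chartDomain (p : ℙ K V) : ∃ φ : Module.Dual K V, p ∈ chartDomain φ := by
  induction p using Projectivization.ind with
  | h v hv =>
    obtain ⟨φ, hφ⟩ := Module.Projective.exists_dual_ne_zero K hv
    exact ⟨φ, hφ⟩

/-- The **normalised representative** `[v] ↦ (φ v)⁻¹ • v` of the chart `U_φ` (Hirzebruch §4.2: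
affine coordinates `zⱼ/zᵢ` on `Uᵢ`); total on `ℙ K V` (junk `0` off `U_φ`, where `(φ v)⁻¹ = 0`).
[cite: Hirzebruch1966, §4.2] -/
def affineRep (φ : Module.Dual K V) : ℙ K V → V :=
  Projectivization.lift (fun v : {v : V // v ≠ 0} ↦ (φ v)⁻¹ • (v : V)) (by
    rintro ⟨v, hv⟩ ⟨w, hw⟩ t (rfl : v = t • w)
    have ht : t ≠ 0 := by rintro rfl; exact hv (zero_smul K w)
    change (φ (t • w))⁻¹ • (t • w) = (φ w)⁻¹ • w
    rw [map_smul, smul_eq_mul, mul_inv, smul_smul, mul_right_comm, inv_mul_cancel₀ ht, one_mul])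

/-- `affineRep φ [v] = (φ v)⁻¹ • v`. [cite: Hirzebruch1966, §4.2] -/
@[simp]
theorem affineRep_mk (φ : Module.Dual K V) (v : V) (hv : v ≠ 0) :
    affineRep φ (Projectivization.mk K v hv) = (φ v)⁻¹ • v := rfl

/-- On `U_φ` the normalised representative has `φ`-coordinate `1`. [cite: Hirzebruch1966, §4.2] -/
theorem apply_affineRep (φ : Module.Dual K V) {p : ℙ K V} (hp : p ∈ chartDomain φ) :
    φ (affineRep φ p) = 1 := by
  induction p using Projectivization.ind with
  | h v hv =>
    rw [affineRep_mk, map_smul, smul_eq_mul, inv_mul_cancel₀ ((mk_mem_chartDomain_iff φ v hv).1 hp)]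

/-- On `U_φ` the normalised representative is nonzero. [folklore] -/
theorem affineRep_ne_zero (φ : Module.Dual K V) {p : ℙ K V} (hp : p ∈ chartDomain φ) :
    affineRep φ p ≠ 0 := fun h ↦ by
  have := apply_affineRep φ hp
  rw [h, map_zero] at this
  exact zero_ne_one this

/-- On `U_φ` the normalised representative represents the point: `[affineRep φ p] = p`.
[cite: Hirzebruch1966, §4.2] -/
theorem mk_affineRep (φ : Module.Dual K V) {p : ℙ K V} (hp : p ∈ chartDomain φ) :
    Projectivization.mk K (affineRep φ p) (affineRep_ne_zero φ hp) = p := by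
  induction p using Projectivization.ind with
  | h v hv =>
    have hφ : φ v ≠ 0 := (mk_mem_chartDomain_iff φ v hv).1 hp
    simp_rw [affineRep_mk]
    rw [Projectivization.mk_eq_mk_iff']
    exact ⟨(φ v)⁻¹, rfl⟩

/-- On `U_φ` the line `[v]` is spanned by its normalised representative. [cite: Hirzebruch1966, §4.2] -/
theorem submodule_eq_span_affineRep (φ : Module.Dual K V) {p : ℙ K V} (hp : p ∈ chartDomain φ) :
    p.submodule = K ∙ affineRep φ p := by
  conv_lhs => rw [← mk_affineRep φ hp]
  rw [Projectivization.submodule_mk]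

/-- The normalised representative of `p` lies on the line `p` (for every `p`). [folklore] -/
theorem affineRep_mem_submodule (φ : Module.Dual K V) (p : ℙ K V) : affineRep φ p ∈ p.submodule := by
  induction p using Projectivization.ind with
  | h v hv =>
    rw [affineRep_mk, Projectivization.submodule_mk]
    exact Submodule.smul_mem _ _ (Submodule.mem_span_singleton_self v)

/-- Two points of `U_φ` with the same normalised representative are equal. [folklore] -/
theorem affineRep_injOn (φ : Module.Dual K V) : InjOn (affineRep φ) (chartDomain φ : Set (ℙ K V)) :=
  fun p hp q hq h ↦ by rw [← mk_affineRep φ hp, ← mk_affineRep φ hq]; simp_rw [h]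

end Chart

section ChartTopology

variable {K : Type u} {V : Type v} [Field K] [AddCommGroup V] [Module K V] [TopologicalSpace K]
  [T1Space K] [TopologicalSpace V]

/-- **`U_φ` is open** when `φ` is continuous (and points of `K` are closed). [cite: Hirzebruch1966, §4.2] -/
theorem isOpen_chartDomain (φ : Module.Dual K V) (hφ : Continuous φ) :
    IsOpen (chartDomain φ : Set (ℙ K V)) := by
  rw [← Projectivization.isQuotientMap_mk.isOpen_preimage]
  exact (isOpen_compl_singleton (x := (0 : K))).preimage (hφ.comp continuous_subtype_val)

variable [ContinuousInv₀ K] [ContinuousSMul K V]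

/-- **The normalised representative is continuous on `U_φ`** (for `φ` continuous): on the open
set `U_φ` continuity may be tested after composing with the quotient map, where the map is
`v ↦ (φ v)⁻¹ • v`. [cite: Hirzebruch1966, §4.2] -/
theorem continuousOn_affineRep (φ : Module.Dual K V) (hφ : Continuous φ) :
    ContinuousOn (affineRep φ) (chartDomain φ : Set (ℙ K V)) := by
  rw [continuousOn_iff_comp_mk' (isOpen_chartDomain φ hφ), preimage_mk'_chartDomain]
  exact ((hφ.comp continuous_subtype_val).continuousOn.inv₀ fun v hv ↦ hv).smul
    continuous_subtype_val.continuousOn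

end ChartTopology

end Literature.AlgebraicTopology.CharacteristicClasses
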